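import Mathlib
import HarnessLib
import Literature.Analysis.FluidPDE.KochTataru
import Literature.Analysis.FluidPDE.KochTataruKernel
import Literature.Analysis.FluidPDE.KochTataruPointwise
import Literature.Analysis.FluidPDE.VectorCalculus
import Literature.Analysis.FluidPDE.NSBoundedMildOseen
import Literature.Analysis.FluidPDE.NSBoundedMildOseenDuhamel
import Literature.Analysis.FluidPDE.NSBoundedMildOseenRestart
import Literature.Analysis.FluidPDE.NSBoundedMildSmoothing
import Literature.Analysis.FluidPDE.KNSSMildDecayHorizontal
import Literature.Analysis.UnboundedOperators.HeatKernel
import Literature.Analysis.UnboundedOperators.HeatExtensionDecay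
import Literature.Analysis.UnboundedOperators.HeatKernelBoundedData
import Literature.Analysis.UnboundedOperators.HeatKernelGaussianData
import Literature.Analysis.UnboundedOperators.HeatKernelTimeModulus
import Summits.NavierStokesRegularity.NavierStokesRegularity.Theorems.ThreadingFluxPoloidalLiouvillePrecessionOseenTimeLipschitz
import Summits.NavierStokesRegularity.NavierStokesRegularity.Theorems.ThreadingFluxPoloidalLiouvillePrecessionShortPeriodKernel
import Summits.NavierStokesRegularity.NavierStokesRegularity.Theorems.ThreadingFluxPoloidalLiouvillePrecessionShortPeriodPieces

/-!
# Route `ThreadingFlux`, item `PoloidalLiouville` (W1, stmt-NavierStokesRegularity-1222) — crux idea «precession-gap» (ns-idea-15,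
# `Cruxes/PoloidalLiouville/PrecessionSketch.lean` (D)): **D `ShortPeriodCollapse` PROVED** — an honest Oseen-mild, bounded (`‖u‖ ≤ B`), jointly `C²`,
# time-periodic solution on `ℝ × ℝ³` with period `P` and `P·B² ≤ c₀` is STEADY

Cell ns-regularity-ideate, seat ns-poloidal-K2-p2 g13.  `shortPeriodCollapse` has EXACTLY the type of the hypothesis `hD` of
`…PrecessionFastW1.fastPrecessionPoloidalLiouville_of_shortPeriodCollapse` (= the body of `Precession.ShortPeriodCollapse` with the sketch-local
`IsOseenMildOn univ u` unfolded), so the W1 rung F and the W2 rung G become unconditional by one application each (next file).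

PROOF (the sketch's mechanism, in the SHIFT form — no period averages needed).  Fix `h > 0` and let `W = sup‖u(·+h) − u‖`.  For `N ≥ 1`, periodicity and
the mild identity from `t − NP` give the exact identity
`u(t+h) − u(t) = [e^{NPΔ}u(t+h) − e^{NPΔ}u(t)] − [B_{t−NP}(u_h,u_h)(t) − B_{t−NP}(u,u)(t)]` (`Literature.Analysis.FluidPDE.oseenDuhamel_translate`).
The Duhamel bracket is `≤ C_D√P·B·W` uniformly in `N` (`…ShortPeriodPieces.norm_oseenDuhamel_pair_sub_le`: near period `√P`, `k`-th past period `√P k^{-3/2}`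
because the forcing `u_h⊗u_h − u⊗u` has zero period mean).  The FREE bracket tends to `0` as `N → ∞` (`norm_heatExtension_shift_sub_le_of_large`): by the mild
identity `u(t+h) = e^{hΔ}u(t) − B_t(u,u)(t+h)`, so `e^{θΔ}u(t+h) − e^{θΔ}u(t) = (e^{(θ+h)Δ} − e^{θΔ})u(t) − ∫_t^{t+h}∫K(θ+t+h−τ)[u,u]`
(semigroup `Literature.Analysis.UnboundedOperators.heatExtension_heatExtension_apply_of_integrable_heatKernel_mul_norm`, kernel shift
`Literature.Analysis.FluidPDE.heatExtension_oseenDuhamel_eq_setIntegral`), of size `≤ B∫|G_{θ+h} − G_θ| + C₁hθ^{-1/2}B²`, and `∫|G_{θ+h} − G_θ| = ∫|G_{1+h/θ} − G_1| → 0`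
(`integral_abs_heatKernel_sub_mul`, `tendsto_integral_abs_heatKernel_add_sub`).  Hence `W ≤ C_D√P·B·W ≤ W/2` once `P B² ≤ c₀ := 1/(4C_D²)`: `W = 0`,
`u(·+h) = u` for every `h > 0`, i.e. `u` is steady.

HONEST LABEL: a general small-data rigidity lemma for the Oseen integral equation (no axisymmetry, no threading hypothesis); with it the CONDITIONAL rungs
F (p674652) / G (p675054, p679393) become theorems, deciding NON-EXISTENCE on the fast half `C·B² ≤ |Ω|` of the precessing stratum; the slow half, the
steady stratum and W1 / W2 themselves stay OPEN; movement on 1222 / 27585 as items = 0.  No claim about Navier–Stokes regularity.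
-/

noncomputable section

-- the summit and its single sub-problem share the name (CONVENTIONS §1), as in every Theorems file
set_option linter.dupNamespace false

namespace Summit.NavierStokesRegularity.NavierStokesRegularity.Theorems.ThreadingFluxPoloidalLiouvillePrecessionShortPeriodCollapse

open MeasureTheory Set Function Filter Topology
open scoped RealInnerProductSpace ENNReal
open Literature.Analysis Literature.Analysis.FluidPDE Literature.Analysis.UnboundedOperators
open Summit.NavierStokesRegularity.NavierStokesRegularity.Theorems.ThreadingFluxPoloidalLiouvillePrecessionOseenTimeLipschitz
open Summit.NavierStokesRegularity.NavierStokesRegularity.Theorems.ThreadingFluxPoloidalLiouvillePrecessionShortPeriodKernel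
open Summit.NavierStokesRegularity.NavierStokesRegularity.Theorems.ThreadingFluxPoloidalLiouvillePrecessionShortPeriodPieces

/-! ## The free term -/

/-- **Pointwise time modulus of the heat flow on bounded data**: `‖e^{tΔ}g(x) − e^{sΔ}g(x)‖ ≤ (∫|G_t − G_s|)·C` for `‖g‖ ≤ C` measurable, `s, t > 0`. [folklore] -/
theorem norm_heatExtension_sub_le_of_bound {g : EuclideanSpace ℝ (Fin 3) → EuclideanSpace ℝ (Fin 3)} (hgm : AEStronglyMeasurable g volume)
    {C : ℝ} (hC : ∀ z, ‖g z‖ ≤ C) {s t : ℝ} (hs : 0 < s) (ht : 0 < t) (x : EuclideanSpace ℝ (Fin 3)) :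
    ‖heatExtension g t x - heatExtension g s x‖ ≤ (∫ z : EuclideanSpace ℝ (Fin 3), |heatKernel t z - heatKernel s z|) * C := by
  have hC0 : 0 ≤ C := (norm_nonneg _).trans (hC 0)
  have hmem : MemLp g ∞ (volume : Measure (EuclideanSpace ℝ (Fin 3))) := memLp_top_of_bound hgm C (Eventually.of_forall hC)
  rw [heatExtension_sub_heatExtension_eq_convolution hmem le_top hs ht x, convolution_def]
  have hKi : Integrable (fun z : EuclideanSpace ℝ (Fin 3) => heatKernel t z - heatKernel s z) :=
    (integrable_heatKernel_holds ht).sub (integrable_heatKernel_holds hs)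
  have hbound : Integrable (fun y : EuclideanSpace ℝ (Fin 3) => |heatKernel t y - heatKernel s y| * C) := hKi.abs.mul_const C
  calc ‖∫ y, (ContinuousLinearMap.lsmul ℝ ℝ) (heatKernel t y - heatKernel s y) (g (x - y))‖
      ≤ ∫ y, |heatKernel t y - heatKernel s y| * C := by
        refine norm_integral_le_of_norm_le hbound (Eventually.of_forall fun y => ?_)
        rw [ContinuousLinearMap.lsmul_apply, norm_smul, Real.norm_eq_abs]
        exact mul_le_mul_of_nonneg_left (hC _) (abs_nonneg _)
    _ = (∫ z : EuclideanSpace ℝ (Fin 3), |heatKernel t z - heatKernel s z|) * C := integral_mul_const _ _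

/-- **The `L¹` distance of two heat kernels at large times is small**: for `h > 0` and `η > 0` there is `Θ > 0` with `∫|G_{θ+h} − G_θ| < η` for all `θ ≥ Θ`
(`∫|G_{θ+h} − G_θ| = ∫|G_{1+h/θ} − G_1|`, continuity of the kernel in `L¹` at time `1`). [folklore] -/
theorem exists_integral_abs_heatKernel_sub_lt {h : ℝ} (hh : 0 < h) {η : ℝ} (hη : 0 < η) :
    ∃ Θ : ℝ, 0 < Θ ∧ ∀ θ : ℝ, Θ ≤ θ →
      ∫ z : EuclideanSpace ℝ (Fin 3), |heatKernel (θ + h) z - heatKernel θ z| < η := by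
  have hT := Metric.tendsto_nhdsWithin_nhds.1 (tendsto_integral_abs_heatKernel_add_sub (E := EuclideanSpace ℝ (Fin 3))) η hη
  obtain ⟨ε, hε, hω⟩ := hT
  refine ⟨2 * h / ε, by positivity, fun θ hθ => ?_⟩
  have hθ0 : 0 < θ := lt_of_lt_of_le (by positivity) hθ
  set r : ℝ := h / θ with hr
  have hr0 : 0 ≤ r := by positivity
  have hrε : r < ε := by
    rw [hr, div_lt_iff₀ hθ0]
    have : 2 * h ≤ θ * ε := (div_le_iff₀ hε).1 hθ
    linarith
  have h1 := hω (x := r) (by exact hr0) (by rwa [Real.dist_eq, sub_zero, abs_of_nonneg hr0])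
  rw [Real.dist_eq, sub_zero, abs_of_nonneg (integral_nonneg fun w => abs_nonneg _)] at h1
  have hscale : ∫ z : EuclideanSpace ℝ (Fin 3), |heatKernel (θ + h) z - heatKernel θ z| =
      ∫ w : EuclideanSpace ℝ (Fin 3), |heatKernel (1 + r) w - heatKernel 1 w| := by
    have e1 : θ + h = θ * (1 + r) := by rw [hr]; field_simp
    have e2 : heatKernel (E := EuclideanSpace ℝ (Fin 3)) θ = heatKernel (θ * 1) := by rw [mul_one]
    rw [e1, e2, integral_abs_heatKernel_sub_mul hθ0 (by positivity) one_pos]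
  rw [hscale]
  exact h1

/-- **The free term is small at large times**: for `u` jointly continuous, bounded by `B`, honest Oseen-mild, and `h > 0`: for every `δ > 0` there is `Θ > 0`
such that `‖e^{θΔ}u(t+h)(x) − e^{θΔ}u(t)(x)‖ ≤ δ` for all `θ ≥ Θ`.  Mechanism: `u(t+h) = e^{hΔ}u(t) − B_t(u,u)(t+h)`, semigroup law and kernel shift
(see the module docstring). [folklore] -/
theorem norm_heatExtension_shift_sub_le_of_large {u : ℝ → EuclideanSpace ℝ (Fin 3) → EuclideanSpace ℝ (Fin 3)} {B : ℝ}
    (hcont : Continuous (uncurry u)) (hbd : ∀ τ y, ‖u τ y‖ ≤ B)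
    (hmild : ∀ s t : ℝ, s < t → ∀ x, u t x = heatExtension (u s) (t - s) x - oseenDuhamel 1 s u u t x)
    {h : ℝ} (hh : 0 < h) (t : ℝ) (x : EuclideanSpace ℝ (Fin 3)) {δ : ℝ} (hδ : 0 < δ) :
    ∃ Θ : ℝ, 0 < Θ ∧ ∀ θ : ℝ, Θ ≤ θ → ‖heatExtension (u (t + h)) θ x - heatExtension (u t) θ x‖ ≤ δ := by
  have hB : 0 ≤ B := (norm_nonneg _).trans (hbd 0 0)
  have hum : Measurable (uncurry u) := hcont.measurable
  have hslice : ∀ τ, Continuous (u τ) := fun τ => hcont.comp (continuous_const.prodMk continuous_id)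
  obtain ⟨C₁, hC₁, hsl⟩ := exists_lintegral_enorm_oseenKernel_comp_sub_le_of_bound (E := EuclideanSpace ℝ (Fin 3))
  -- the two smallness thresholds
  obtain ⟨Θ₁, hΘ₁, hG⟩ := exists_integral_abs_heatKernel_sub_lt hh (η := δ / (2 * (B + 1))) (by positivity)
  set Θ₂ : ℝ := (2 * h * C₁ * (B ^ 2 + 1) / δ) ^ 2 with hΘ₂
  refine ⟨Θ₁ + Θ₂ + 1, by positivity, fun θ hθ => ?_⟩
  have hθ1 : Θ₁ ≤ θ := by nlinarith [sq_nonneg (2 * h * C₁ * (B ^ 2 + 1) / δ)]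
  have hθ0 : 0 < θ := hΘ₁.trans_le hθ1
  have hθ2 : Θ₂ ≤ θ := by linarith
  -- (1) `u(t+h) = e^{hΔ}u(t) − B_t(u,u)(t+h)` as functions
  have hth : t < t + h := by linarith
  have hfun : u (t + h) = fun y => heatExtension (u t) h y - oseenDuhamel 1 t u u (t + h) y := by
    funext y; have := hmild t (t + h) hth y; rwa [add_sub_cancel_left] at this
  -- continuity and bounds of the two pieces
  have hheat_cont : Continuous (heatExtension (u t) h) := (contDiff_heatExtension_of_bound (hslice t) (hbd t) hh (m := 0)).continuous
  have hheat_bd : ∀ y, ‖heatExtension (u t) h y‖ ≤ B := fun y => norm_heatExtension_le_of_bound (hbd t) hh y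
  have hmeas : AEStronglyMeasurable (uncurry u) ((volume : Measure (ℝ × EuclideanSpace ℝ (Fin 3))).restrict (Ioo t (t + h) ×ˢ univ)) :=
    hcont.aestronglyMeasurable.restrict
  have hD_cont : Continuous (oseenDuhamel 1 t u u (t + h)) :=
    continuous_oseenDuhamel_slice one_pos hB hmeas hmeas (fun τ _ y => hbd τ y) (fun τ _ y => hbd τ y) hth le_rfl
  obtain ⟨C₂, hC₂, hDb⟩ := exists_norm_oseenDuhamel_bounded_le (E := EuclideanSpace ℝ (Fin 3))
  have hD_bd : ∀ y, ‖oseenDuhamel 1 t u u (t + h) y‖ ≤ C₂ * B ^ 2 * (1 : ℝ) ^ (-(1 / 2 : ℝ)) * (2 * Real.sqrt (t + h - t)) :=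
    fun y => hDb one_pos hth hB (fun τ _ y => hbd τ y) (fun τ _ y => hbd τ y) y
  -- (2) split the heat flow of `u(t+h)`
  have hsplit : heatExtension (u (t + h)) θ x =
      heatExtension (heatExtension (u t) h) θ x - heatExtension (oseenDuhamel 1 t u u (t + h)) θ x := by
    rw [hfun]
    exact heatExtension_sub_of_bound hheat_cont hD_cont hheat_bd hD_bd hθ0 x
  -- (3) semigroup law on the first piece
  have hG' : ∀ a : ℝ, 0 < a → Integrable (fun y => heatKernel a y * ‖u t y‖) volume := fun a ha =>
    ((integrable_heatKernel_holds ha).mul_const B).mono'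
      ((continuous_heatKernel a).aestronglyMeasurable.mul (hslice t).norm.aestronglyMeasurable)
      (Eventually.of_forall fun y => by
        rw [Real.norm_eq_abs, abs_mul, abs_of_pos (heatKernel_pos ha y), abs_of_nonneg (norm_nonneg _)]
        exact mul_le_mul_of_nonneg_left (hbd t y) (heatKernel_pos ha y).le)
  have hsemi : heatExtension (heatExtension (u t) h) θ x = heatExtension (u t) (θ + h) x :=
    heatExtension_heatExtension_apply_of_integrable_heatKernel_mul_norm (hslice t).aestronglyMeasurable hG' hh hθ0 x
  -- (4) kernel shift on the second piece
  have hshift : heatExtension (oseenDuhamel 1 t u u (t + h)) θ x =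
      ∫ τ in Ioo t (t + h), ∫ y, oseenKernel (1 * (t + h + θ - τ)) (x - y) (u τ y) (u τ y) := by
    have h1 := heatExtension_oseenDuhamel_eq_setIntegral (ν := 1) (w := u) one_pos hum hbd hth (show t + h < t + h + θ by linarith) x
    rwa [show (1 : ℝ) * (t + h + θ - (t + h)) = θ by ring] at h1
  -- (5) bound of the second piece: `≤ h · C₁ θ^{-1/2} B²`
  have hpiece : ‖∫ τ in Ioo t (t + h), ∫ y, oseenKernel (1 * (t + h + θ - τ)) (x - y) (u τ y) (u τ y)‖ ≤
      h * (C₁ * θ ^ (-(1 / 2 : ℝ)) * B ^ 2) := by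
    have hpt : ∀ τ ∈ Ioo t (t + h), ‖∫ y, oseenKernel (1 * (t + h + θ - τ)) (x - y) (u τ y) (u τ y)‖ ≤ C₁ * θ ^ (-(1 / 2 : ℝ)) * B ^ 2 := by
      intro τ hτ
      have hσ : 0 < 1 * (t + h + θ - τ) := by rw [one_mul]; linarith [hτ.2]
      have h0 := norm_integral_slice_le (u := u) hC₁ hsl hB hbd hσ τ x
      refine h0.trans ?_
      have hmono : (1 * (t + h + θ - τ)) ^ (-(1 / 2 : ℝ)) ≤ θ ^ (-(1 / 2 : ℝ)) :=
        Real.rpow_le_rpow_of_nonpos hθ0 (by rw [one_mul]; linarith [hτ.2]) (by norm_num)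
      have : 0 ≤ C₁ * B ^ 2 := by positivity
      nlinarith [hmono]
    have hvol : volume (Ioo t (t + h)) < ∞ := measure_Ioo_lt_top
    have h1 := norm_setIntegral_le_of_norm_le_const hvol hpt
    rwa [Real.volume_real_Ioo_of_le hth.le, show t + h - t = h by ring, mul_comm] at h1
  -- (6) assemble
  have hfree : heatExtension (u (t + h)) θ x - heatExtension (u t) θ x =
      (heatExtension (u t) (θ + h) x - heatExtension (u t) θ x) -
        ∫ τ in Ioo t (t + h), ∫ y, oseenKernel (1 * (t + h + θ - τ)) (x - y) (u τ y) (u τ y) := by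
    rw [hsplit, hsemi, hshift]; abel
  rw [hfree]
  have hA : ‖heatExtension (u t) (θ + h) x - heatExtension (u t) θ x‖ ≤ δ / 2 := by
    refine (norm_heatExtension_sub_le_of_bound (hslice t).aestronglyMeasurable (hbd t) hθ0 (by linarith) x).trans ?_
    have hGθ := (hG θ hθ1).le
    have hB1 : B + 1 ≠ 0 := by positivity
    have hfrac : B / (B + 1) ≤ 1 := (div_le_one (by positivity)).2 (by linarith)
    calc (∫ z : EuclideanSpace ℝ (Fin 3), |heatKernel (θ + h) z - heatKernel θ z|) * B ≤ δ / (2 * (B + 1)) * B :=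
          mul_le_mul_of_nonneg_right hGθ hB
      _ = δ / 2 * (B / (B + 1)) := by field_simp
      _ ≤ δ / 2 * 1 := by gcongr
      _ = δ / 2 := mul_one _
  have hB2 : h * (C₁ * θ ^ (-(1 / 2 : ℝ)) * B ^ 2) ≤ δ / 2 := by
    have hsq : Real.sqrt Θ₂ ≤ Real.sqrt θ := Real.sqrt_le_sqrt hθ2
    rw [hΘ₂, Real.sqrt_sq (by positivity)] at hsq
    have hθs : 0 < Real.sqrt θ := Real.sqrt_pos.2 hθ0
    have hrp : θ ^ (-(1 / 2 : ℝ)) = 1 / Real.sqrt θ := by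
      rw [Real.rpow_neg hθ0.le, Real.sqrt_eq_rpow, inv_eq_one_div]
    rw [hrp]
    rw [div_le_iff₀ hδ] at hsq
    have : h * (C₁ * (1 / Real.sqrt θ) * B ^ 2) = h * C₁ * B ^ 2 / Real.sqrt θ := by field_simp
    rw [this, div_le_iff₀ hθs]
    nlinarith [mul_nonneg (mul_nonneg hh.le hC₁.le) (sq_nonneg B)]
  calc _ ≤ ‖heatExtension (u t) (θ + h) x - heatExtension (u t) θ x‖ +
        ‖∫ τ in Ioo t (t + h), ∫ y, oseenKernel (1 * (t + h + θ - τ)) (x - y) (u τ y) (u τ y)‖ := norm_sub_le _ _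
    _ ≤ δ / 2 + δ / 2 := add_le_add hA (hpiece.trans hB2)
    _ = δ := by ring

/-! ## The stub -/

/-- Iterated periodicity backwards, as an equality of slices: `u(τ − nP) = u(τ)`. [folklore] -/
theorem slice_sub_nat_mul_eq {u : ℝ → EuclideanSpace ℝ (Fin 3) → EuclideanSpace ℝ (Fin 3)} {P : ℝ}
    (hper : ∀ t x, u (t + P) x = u t x) (n : ℕ) (τ : ℝ) : u (τ - n * P) = u τ := by
  induction n with
  | zero => simp
  | succ k ih =>
    funext x
    have h := hper (τ - (k + 1) * P) x
    rw [show τ - (k + 1 : ℕ) * P = τ - (k + 1) * P by push_cast; ring]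
    rw [show τ - (k + 1) * P + P = τ - k * P by ring] at h
    rw [← h, ih]

/-- **D `ShortPeriodCollapse` of «precession-gap» (VERBATIM the hypothesis `hD` of `…PrecessionFastW1.fastPrecessionPoloidalLiouville_of_shortPeriodCollapse`,
= the body of `Precession.ShortPeriodCollapse` with `IsOseenMildOn univ` unfolded): short-period bounded honest Oseen-mild time-periodic solutions are steady.**
See the module docstring for the proof. -/
theorem shortPeriodCollapse :
    ∃ c₀ : ℝ, 0 < c₀ ∧ ∀ (u : ℝ → EuclideanSpace ℝ (Fin 3) → EuclideanSpace ℝ (Fin 3)) (P B : ℝ), 0 < P →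
      ContDiff ℝ 2 (uncurry u) → (∀ t, VectorCalculus.IsDivFree (u t)) → (∀ t x, ‖u t x‖ ≤ B) →
      (∀ s ∈ (univ : Set ℝ), ∀ t ∈ (univ : Set ℝ), s < t → ∀ x,
        u t x = heatExtension (u s) (t - s) x - oseenDuhamel 1 s u u t x) →
      (∀ t x, u (t + P) x = u t x) → P * B ^ 2 ≤ c₀ → ∀ s t x, u s x = u t x := by
  -- ## the constants
  obtain ⟨C₀, hC₀, hK⟩ := exists_norm_oseenKernel_three_le
  obtain ⟨C_L, hCL, hP1⟩ := oseenKernelTimeLipschitzL1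
  obtain ⟨C₁, hC₁, hsl⟩ := exists_lintegral_enorm_oseenKernel_comp_sub_le_of_bound (E := EuclideanSpace ℝ (Fin 3))
  obtain ⟨M₀, hM₀⟩ : ∃ M₀ : ℝ, M₀ = ∫ w : EuclideanSpace ℝ (Fin 3), (1 + ‖w‖ ^ 2) ^ (-(2 : ℝ)) := ⟨_, rfl⟩
  have he : (Module.finrank ℝ (EuclideanSpace ℝ (Fin 3)) : ℝ) < 2 * 2 := by
    rw [finrank_real_euclideanSpace_fin_three]; norm_num
  have hM₀pos : 0 < M₀ := by rw [hM₀]; exact integral_one_add_norm_sq_rpow_neg_pos he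
  obtain ⟨C_D, hCD⟩ : ∃ C_D : ℝ, C_D = 4 * C₀ * M₀ + 54 * C_L := ⟨_, rfl⟩
  have hCD0 : 0 < C_D := by rw [hCD]; positivity
  refine ⟨1 / (4 * C_D ^ 2), by positivity, ?_⟩
  intro u P B hP hu2 _hdiv hbd hmild hper hPB s₀ t₀ x₀
  -- ## generalities
  have hB : 0 ≤ B := (norm_nonneg _).trans (hbd 0 0)
  have hcont : Continuous (uncurry u) := hu2.continuous
  have hum : Measurable (uncurry u) := hcont.measurable
  have hmild' : ∀ s t : ℝ, s < t → ∀ x, u t x = heatExtension (u s) (t - s) x - oseenDuhamel 1 s u u t x :=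
    fun s t hst x => hmild s (mem_univ _) t (mem_univ _) hst x
  -- the contraction factor `C_D √P B ≤ 1/2`
  have hhalf : C_D * Real.sqrt P * B ≤ 1 / 2 := by
    have h1 : Real.sqrt (P * B ^ 2) ≤ Real.sqrt (1 / (4 * C_D ^ 2)) := Real.sqrt_le_sqrt hPB
    rw [Real.sqrt_mul hP.le, Real.sqrt_sq hB, show (1 : ℝ) / (4 * C_D ^ 2) = (1 / (2 * C_D)) ^ 2 by field_simp; ring,
      Real.sqrt_sq (by positivity)] at h1
    calc C_D * Real.sqrt P * B = C_D * (Real.sqrt P * B) := by ring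
      _ ≤ C_D * (1 / (2 * C_D)) := mul_le_mul_of_nonneg_left h1 hCD0.le
      _ = 1 / 2 := by field_simp
  -- ## the shift by `h > 0` vanishes
  have key : ∀ h : ℝ, 0 < h → ∀ t x, u (t + h) x = u t x := by
    intro h hh
    -- the supremum `W` of the shift increment
    set f : ℝ × EuclideanSpace ℝ (Fin 3) → ℝ := fun p => ‖u (p.1 + h) p.2 - u p.1 p.2‖ with hf
    have hfbdd : BddAbove (range f) := ⟨B + B, by
      rintro _ ⟨p, rfl⟩
      exact (norm_sub_le _ _).trans (add_le_add (hbd _ _) (hbd _ _))⟩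
    obtain ⟨W, hWdef⟩ : ∃ W : ℝ, W = ⨆ p, f p := ⟨_, rfl⟩
    have hw : ∀ τ y, ‖u (τ + h) y - u τ y‖ ≤ W := fun τ y => by
      rw [hWdef]; exact le_ciSup hfbdd (τ, y)
    have hW : 0 ≤ W := (norm_nonneg _).trans (hw 0 0)
    -- every increment is `≤ C_D √P B W`
    have hincr : ∀ t x, ‖u (t + h) x - u t x‖ ≤ C_D * Real.sqrt P * B * W := by
      intro t x
      refine le_of_forall_pos_le_add fun δ hδ => ?_
      obtain ⟨Θ, hΘ, hfree⟩ := norm_heatExtension_shift_sub_le_of_large hcont hbd hmild' hh t x hδ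
      -- a number of periods beyond the threshold
      obtain ⟨N, hN⟩ := exists_nat_gt (Θ / P)
      have hN1 : 1 ≤ N := by
        have : (0 : ℝ) < N := lt_trans (by positivity) hN
        exact_mod_cast this
      have hNP : Θ ≤ N * P := by rw [div_lt_iff₀ hP] at hN; exact hN.le
      have hNP0 : 0 < (N : ℝ) * P := by positivity
      -- the exact identity from `t − NP`
      have h1 : u t x = heatExtension (u t) (N * P) x - oseenDuhamel 1 (t - N * P) u u t x := by
        have := hmild' (t - N * P) t (by linarith) x
        rwa [slice_sub_nat_mul_eq hper N t, sub_sub_cancel] at this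
      have h2 : u (t + h) x = heatExtension (u (t + h)) (N * P) x -
          oseenDuhamel 1 (t - N * P) (fun τ y => u (τ + h) y) (fun τ y => u (τ + h) y) t x := by
        have := hmild' (t - N * P + h) (t + h) (by linarith) x
        rw [show t - N * P + h = (t + h) - N * P by ring, slice_sub_nat_mul_eq hper N (t + h),
          show t + h - (t + h - N * P) = N * P by ring] at this
        rw [this, show t + h - N * P = t - N * P + h by ring]
        congr 1
        exact (oseenDuhamel_translate 1 (t - N * P) h u u t x).symm
      have hduh := norm_oseenDuhamel_pair_sub_le (u := u) (h := h) hC₀.le hCL hC₁ hK hP1 hsl hum hB hbd hP hper hW hw hN1 t x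
      rw [← hM₀, ← hCD] at hduh
      have hfr := hfree (N * P) hNP
      calc ‖u (t + h) x - u t x‖
          = ‖(heatExtension (u (t + h)) (N * P) x - heatExtension (u t) (N * P) x) -
              (oseenDuhamel 1 (t - N * P) (fun τ y => u (τ + h) y) (fun τ y => u (τ + h) y) t x -
                oseenDuhamel 1 (t - N * P) u u t x)‖ := by rw [h1, h2]; congr 1; abel
        _ ≤ ‖heatExtension (u (t + h)) (N * P) x - heatExtension (u t) (N * P) x‖ +
              ‖oseenDuhamel 1 (t - N * P) (fun τ y => u (τ + h) y) (fun τ y => u (τ + h) y) t x -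
                oseenDuhamel 1 (t - N * P) u u t x‖ := norm_sub_le _ _
        _ ≤ δ + C_D * Real.sqrt P * B * W := add_le_add hfr hduh
        _ = C_D * Real.sqrt P * B * W + δ := add_comm _ _
    -- hence `W ≤ W/2`, `W = 0`
    have hWle : W ≤ C_D * Real.sqrt P * B * W := by
      rw [hWdef]
      refine ciSup_le fun p => ?_
      rw [← hWdef]; exact hincr p.1 p.2
    have hW0 : W = 0 := by
      have : C_D * Real.sqrt P * B * W ≤ 1 / 2 * W := mul_le_mul_of_nonneg_right hhalf hW
      nlinarith
    intro t x
    have := hw t x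
    rw [hW0] at this
    exact sub_eq_zero.1 (norm_le_zero_iff.1 this)
  -- ## conclusion
  rcases lt_trichotomy s₀ t₀ with hlt | heq | hgt
  · have := key (t₀ - s₀) (sub_pos.2 hlt) s₀ x₀
    rw [add_sub_cancel] at this
    exact this.symm
  · rw [heq]
  · have := key (s₀ - t₀) (sub_pos.2 hgt) t₀ x₀
    rw [add_sub_cancel] at this
    exact this

end Summit.NavierStokesRegularity.NavierStokesRegularity.Theorems.ThreadingFluxPoloidalLiouvillePrecessionShortPeriodCollapse

end
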